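import Mathlib
import HarnessLib

/-!
# Amplified critical window — summing the rung inequalities (pure real bookkeeping)
(cell pnp-ideate, rung F-N1/p3, ROUND-11; line `amplified-window` on item stmt-PneNP-19860, stub B
`CriticalWindowHardness`; card HOME/pnp-ideate-p3/r11/amplified-window.md §5 (f))

* `rung_sum_bound` — if `1 − R√e_i ≤ θ + π_{i+1} + e_{i+1}` for `i + 1 < T`, `Σ_{i<T} π_i = T/2`,
  `e_i, π_i ≥ 0`, `θ, R ≥ 0`, then with `ē = (Σ_{i<T} e_i)/T`:  `1/2 − 1/T − θ ≤ R√ē + ē`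
  (sum over the rungs, drop `π_0, e_0 ≥ 0`, Cauchy–Schwarz `Σ√e_i ≤ √(T·Σe_i)`);
* `mean_error_ge` — the numeric consequence: `θ ≤ 1/50`, `T ≥ 100`, `R ≤ 5/2` force `ē ≥ 1/64`.

HONEST FRAMING: arithmetic for the OPEN stub B; FRONTIER rung F-N1 — nothing here bears on P vs NP.
-/

set_option linter.dupNamespace false -- `Summit.PneNP.PneNP.…`: summit = sub-problem name (D-0017 single-conjunct layout)

namespace Summit.PneNP.PneNP.Theorems.NegLimitedDoor.AmplifiedWindowBase

open Finset

/-- Cauchy–Schwarz for square roots: `Σ_{i<T} √e_i ≤ √(T · Σ_{i<T} e_i)` for `e_i ≥ 0`. -/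
theorem sum_sqrt_le_sqrt_card_mul (T : ℕ) (e : ℕ → ℝ) (he : ∀ i ∈ range T, 0 ≤ e i) :
    ∑ i ∈ range T, Real.sqrt (e i) ≤ Real.sqrt (T * ∑ i ∈ range T, e i) := by
  have hsq : (∑ i ∈ range T, Real.sqrt (e i)) ^ 2 ≤ (∑ i ∈ range T, (1 : ℝ)) * ∑ i ∈ range T, e i := by
    refine sum_sq_le_sum_mul_sum_of_sq_le_mul (range T) (fun _ _ => zero_le_one) he fun i hi => ?_
    rw [one_mul, Real.sq_sqrt (he i hi)]
  rw [sum_const, card_range, nsmul_eq_mul, mul_one] at hsq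
  exact (le_abs_self _).trans (Real.abs_le_sqrt hsq)

/-- **Summing the rungs.**  From the per-rung inequalities `1 − R√e_i ≤ θ + π_{i+1} + e_{i+1}`
(`i + 1 < T`), exact balance `Σ_{i<T} π_i = T/2` and nonnegativity:
`1/2 − 1/T − θ ≤ R·√ē + ē`, `ē = (Σ_{i<T} e_i)/T`. -/
theorem rung_sum_bound {T : ℕ} (hT : 2 ≤ T) {θ R : ℝ} (hθ : 0 ≤ θ) (hR : 0 ≤ R) (e π : ℕ → ℝ)
    (he0 : ∀ i ∈ range T, 0 ≤ e i) (hπ0 : ∀ i ∈ range T, 0 ≤ π i)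
    (hπ : ∑ i ∈ range T, π i = T / 2)
    (hrung : ∀ i, i + 1 < T → 1 - R * Real.sqrt (e i) ≤ θ + π (i + 1) + e (i + 1)) :
    1 / 2 - 1 / T - θ ≤ R * Real.sqrt ((∑ i ∈ range T, e i) / T) + (∑ i ∈ range T, e i) / T := by
  have hT0 : (0 : ℝ) < T := by exact_mod_cast (show 0 < T by omega)
  set S := ∑ i ∈ range T, e i with hS
  set Q := ∑ i ∈ range T, Real.sqrt (e i) with hQ
  have hS0 : 0 ≤ S := sum_nonneg he0
  -- `T = (T-1) + 1`
  obtain ⟨T', rfl⟩ : ∃ T', T = T' + 1 := ⟨T - 1, by omega⟩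
  -- sum the rung inequalities over `i < T'`
  have hsum : ∑ i ∈ range T', (1 - R * Real.sqrt (e i)) ≤ ∑ i ∈ range T', (θ + π (i + 1) + e (i + 1)) :=
    sum_le_sum fun i hi => hrung i (by have := mem_range.1 hi; omega)
  rw [sum_sub_distrib, sum_const, card_range, nsmul_eq_mul, mul_one, ← mul_sum, sum_add_distrib,
    sum_add_distrib, sum_const, card_range, nsmul_eq_mul] at hsum
  -- the shifted sums are at most the full sums
  have hπs : ∑ i ∈ range T', π (i + 1) ≤ (T' + 1 : ℕ) / 2 := by
    have h := sum_range_succ' π T'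
    have h0 : 0 ≤ π 0 := hπ0 0 (mem_range.2 (by omega))
    rw [hπ] at h
    linarith
  have hes : ∑ i ∈ range T', e (i + 1) ≤ S := by
    have h := sum_range_succ' e T'
    have h0 : 0 ≤ e 0 := he0 0 (mem_range.2 (by omega))
    rw [hS]
    linarith
  have hQs : ∑ i ∈ range T', Real.sqrt (e i) ≤ Q := by
    rw [hQ, sum_range_succ]
    linarith [Real.sqrt_nonneg (e T')]
  -- Cauchy–Schwarz: `Q ≤ √(T S) = T √(S/T)`
  have hQcs : Q ≤ ((T' + 1 : ℕ) : ℝ) * Real.sqrt (S / ((T' + 1 : ℕ) : ℝ)) := by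
    have h := sum_sqrt_le_sqrt_card_mul (T' + 1) e he0
    have heq : Real.sqrt (((T' + 1 : ℕ) : ℝ) * S) = ((T' + 1 : ℕ) : ℝ) * Real.sqrt (S / ((T' + 1 : ℕ) : ℝ)) := by
      rw [show ((T' + 1 : ℕ) : ℝ) * S = ((T' + 1 : ℕ) : ℝ) ^ 2 * (S / ((T' + 1 : ℕ) : ℝ)) by
        field_simp, Real.sqrt_mul (by positivity), Real.sqrt_sq hT0.le]
    rw [← heq]
    exact h
  have hθT : (T' : ℝ) * θ ≤ ((T' + 1 : ℕ) : ℝ) * θ := by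
    push_cast
    nlinarith
  -- combine: `(T-1) − R·T√(S/T) ≤ T θ + T/2 + S`, then divide by `T`
  have hRQ : R * ∑ i ∈ range T', Real.sqrt (e i) ≤ R * (((T' + 1 : ℕ) : ℝ) * Real.sqrt (S / ((T' + 1 : ℕ) : ℝ))) :=
    mul_le_mul_of_nonneg_left (hQs.trans hQcs) hR
  have hmain : (T' : ℝ) - R * (((T' + 1 : ℕ) : ℝ) * Real.sqrt (S / ((T' + 1 : ℕ) : ℝ))) ≤
      ((T' + 1 : ℕ) : ℝ) * θ + ((T' + 1 : ℕ) : ℝ) / 2 + S := by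
    linarith
  have hT' : (T' : ℝ) = ((T' + 1 : ℕ) : ℝ) - 1 := by push_cast; ring
  rw [hT'] at hmain
  rw [show (1 : ℝ) / 2 - 1 / ((T' + 1 : ℕ) : ℝ) - θ =
      ((((T' + 1 : ℕ) : ℝ) - 1) - (((T' + 1 : ℕ) : ℝ) * θ + ((T' + 1 : ℕ) : ℝ) / 2)) / ((T' + 1 : ℕ) : ℝ) by
    field_simp; ring]
  rw [div_le_iff₀ hT0]
  have : (R * Real.sqrt (S / ((T' + 1 : ℕ) : ℝ)) + S / ((T' + 1 : ℕ) : ℝ)) * ((T' + 1 : ℕ) : ℝ) =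
      R * (((T' + 1 : ℕ) : ℝ) * Real.sqrt (S / ((T' + 1 : ℕ) : ℝ))) + S := by
    field_simp
  rw [this]
  linarith

/-- **Numeric consequence**: `θ ≤ 1/50`, `T ≥ 100`, `R ≤ 5/2` and `1/2 − 1/T − θ ≤ R√ē + ē` force
`ē ≥ 1/64`. -/
theorem mean_error_ge {e θ R : ℝ} (he0 : 0 ≤ e) (hθ : θ ≤ 1 / 50) {T : ℕ} (hT : 100 ≤ T)
    (hR : R ≤ 5 / 2) (h : 1 / 2 - 1 / T - θ ≤ R * Real.sqrt e + e) :
    1 / 64 ≤ e := by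
  by_contra hlt
  have he : e < 1 / 64 := not_le.mp hlt
  have hsqrt : Real.sqrt e < 1 / 8 := by
    rw [show (1 : ℝ) / 8 = Real.sqrt (1 / 64) by
      rw [show (1 : ℝ) / 64 = (1 / 8) ^ 2 by norm_num, Real.sqrt_sq (by norm_num)]]
    exact Real.sqrt_lt_sqrt he0 he
  have hT' : (100 : ℝ) ≤ T := by exact_mod_cast hT
  have hT0 : (0 : ℝ) < T := by linarith
  have hinv : 1 / (T : ℝ) ≤ 1 / 100 := one_div_le_one_div_of_le (by norm_num) hT'
  have hRs : R * Real.sqrt e ≤ 5 / 2 * (1 / 8) :=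
    mul_le_mul hR hsqrt.le (Real.sqrt_nonneg _) (by norm_num)
  linarith

end Summit.PneNP.PneNP.Theorems.NegLimitedDoor.AmplifiedWindowBase
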